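import Summits.SmoothPoincare4.SmoothPoincare4.Theorems.SullivanDualWitnessChargeHelperRescaleAwayMain
import Summits.SmoothPoincare4.SmoothPoincare4.Theorems.SullivanDualWitnessChargeWeierstrass
import Summits.SmoothPoincare4.SmoothPoincare4.Theorems.SullivanDualWitnessChargeHelperMemberUniform
import Summits.SmoothPoincare4.SmoothPoincare4.Theorems.SullivanDualWitnessChargeHelperMemberNearBound
import Summits.SmoothPoincare4.SmoothPoincare4.Theorems.SullivanDualWitnessChargeHelperMemberFarCovers
import Summits.SmoothPoincare4.SmoothPoincare4.Theorems.SullivanDualHyperbolicEndStandardSphere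
import Literature.Geometry.Symplectic.JHolomorphicReparametrisation
import Mathlib.Analysis.Complex.Basic

/-!
# Sub-stub `substub_blowupCurve` of skeleton v4, line `Sketch`, crux `WitnessCharge`
(item stmt-SmoothPoincare4-7824; route `SullivanDual`, crux
`Summit.SmoothPoincare4.SmoothPoincare4.Theses.SullivanDual.WitnessCharge`; line `Sketch`,
registered stub `substub_blowupCurve` — branch (B) of the closedness step of the pencil argument)

**Gradient blow-up of pencil members with bounded intercepts on a fixed disc produces an entire
`J`-curve staying away from `p`.** Let `J` (with `J² = -1`, smooth) be standard on the punctured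
`ε'`-chart-ball at `p`, `ι : Σ → ℝᴺ` a smooth injective immersion, and `u n` pencil members of
intercepts `‖b n‖ ≤ B` whose gradients through `ι` are unbounded on the disc `‖ξ‖ ≤ r`. Then
`CurveAway S p J`.

Proof (assembly of landed helpers).
1. Uniform confinement (`helper_memberUniform_of`, fed with `helper_memberNearBound_of
   helper_memberFarCovers`): there is `η > 0` such that every member of intercept `‖b‖ ≤ B` maps the
   disc `‖ξ‖ ≤ r + 2` into the core `K = {x | x ∉ B_η}`, compact by
   `isCompact_setOf_not_inPuncturedChartBall` (`Σ` compact).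
2. Blow-up sequence: `‖ξ m‖ ≤ r` and `m < ‖d(ι ∘ u (n m))(ξ m)‖`.
3. Translate: `v m z = u (n m) (z + ξ m)` is an entire `J`-curve (`IsEntireJCurve.comp_affine`),
   maps `‖z‖ ≤ 2` into `K` (`‖z + ξ m‖ ≤ r + 2`), and `d(ι ∘ v m)(0) = d(ι ∘ u (n m))(ξ m)`
   (`fderiv_comp_add_right`), so the gradients of the `v m` are unbounded on the unit disc.
4. Apply the landed rescaling assembly `helper_rescaleAway` with the proved generalized Weierstraß
   theorem `jHolomorphicWeierstrassR4_holds`.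
-/

noncomputable section

-- the registered namespace `Summit.SmoothPoincare4.SmoothPoincare4.…` repeats a component
set_option linter.dupNamespace false

open scoped Manifold ContDiff Topology
open Set Filter Literature.Geometry.Kaehler Literature.Geometry.Symplectic
  Literature.Topology.FourManifolds

namespace Summit.SmoothPoincare4.SmoothPoincare4.Theorems.WitnessCharge.PencilIncompleteness

/-- Translating the parameter of an entire `J`-curve gives an entire `J`-curve:
`z ↦ u (z + ξ)` (the case `a = 1` of `IsEntireJCurve.comp_affine`). -/
theorem isEntireJCurve_comp_add_right {S : HomotopySphere 4} {p : S.carrier}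
    {J : ∀ x : punctured p, TangentSpace (𝓡 4) x →L[ℝ] TangentSpace (𝓡 4) x}
    {u : ℂ → punctured p} (hu : IsEntireJCurve (𝓡 4) J u) (ξ : ℂ) :
    IsEntireJCurve (𝓡 4) J (fun z => u (z + ξ)) := by
  have h := hu.comp_affine one_ne_zero ξ
  have e : (u ∘ fun z => (1 : ℂ) * z + ξ) = fun z => u (z + ξ) :=
    funext fun z => by simp only [Function.comp_apply, one_mul]
  rwa [e] at h

/-- The gradient (through a map `ι`) of the translated curve `z ↦ u (z + ξ)` at `0` is the
gradient of `u` at `ξ` (`fderiv_comp_add_right`). -/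
theorem fderiv_translate_zero {S : HomotopySphere 4} {p : S.carrier} {N : ℕ}
    (ι : S.carrier → EuclideanSpace ℝ (Fin N)) (u : ℂ → punctured p) (ξ : ℂ) :
    fderiv ℝ (fun w : ℂ => ι (u (w + ξ)).1) 0 = fderiv ℝ (fun w : ℂ => ι (u w).1) ξ := by
  have h := fderiv_comp_add_right (𝕜 := ℝ) (f := fun w : ℂ => ι (u w).1) (x := (0 : ℂ)) ξ
  rwa [zero_add] at h

/-- **Sub-stub 2B (skeleton v4) — branch (B): gradient blow-up of members with bounded intercepts
on a fixed disc produces an entire `J`-curve staying away from `p`.** Members with `‖bₙ‖ ≤ B` map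
the disc `‖ξ‖ ≤ r + 2` into a fixed compact `{x | x ∉ B_η}` (`helper_memberUniform_of` with
`helper_memberNearBound_of helper_memberFarCovers`, `isCompact_setOf_not_inPuncturedChartBall`);
translating the blow-up points to the origin (`IsEntireJCurve.comp_affine`,
`fderiv_comp_add_right`) and applying the landed rescaling assembly `helper_rescaleAway` with the
proved generalized Weierstraß theorem `jHolomorphicWeierstrassR4_holds` gives `CurveAway`. -/
theorem substub_blowupCurve :
    ∀ (S : HomotopySphere 4) (p : S.carrier)
      (J : ∀ x : punctured p, TangentSpace (𝓡 4) x →L[ℝ] TangentSpace (𝓡 4) x) (ε' : ℝ),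
      0 < ε' →
      Metric.closedBall (extChartAt (𝓡 4) p p) ε' ⊆ (extChartAt (𝓡 4) p).target →
      (∀ (x : punctured p) (v : TangentSpace (𝓡 4) x), J x (J x v) = -v) →
      (∀ x₀ : punctured p, ContMDiffAt (𝓡 4) 𝓘(ℝ, EuclideanSpace ℝ (Fin 4) →L[ℝ] EuclideanSpace ℝ (Fin 4)) ∞
        (inTangentCoordinates (𝓡 4) (𝓡 4) (id : punctured p → punctured p) id (fun x => J x) x₀) x₀) →
      (∀ x : punctured p, InPuncturedChartBall p ε' x →
        ∀ (v : TangentSpace (𝓡 4) x) (b : EuclideanSpace ℝ (Fin 4)),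
          inner ℝ (fderiv ℝ inversion (extChartAt (𝓡 4) p x.1 - extChartAt (𝓡 4) p p)
            (mfderiv (𝓡 4) 𝓘(ℝ, EuclideanSpace ℝ (Fin 4))
              (fun z : punctured p => extChartAt (𝓡 4) p z.1) x (J x v))) b
          = stdSymplecticForm (fderiv ℝ inversion (extChartAt (𝓡 4) p x.1 - extChartAt (𝓡 4) p p)
            (mfderiv (𝓡 4) 𝓘(ℝ, EuclideanSpace ℝ (Fin 4))
              (fun z : punctured p => extChartAt (𝓡 4) p z.1) x v)) b) →
      ∀ (N : ℕ) (ι : S.carrier → EuclideanSpace ℝ (Fin N)),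
        ContMDiff (𝓡 4) 𝓘(ℝ, EuclideanSpace ℝ (Fin N)) ∞ ι → Function.Injective ι →
        (∀ x : S.carrier, Function.Injective (mfderiv (𝓡 4) 𝓘(ℝ, EuclideanSpace ℝ (Fin N)) ι x)) →
      ∀ (u : ℕ → ℂ → punctured p) (b : ℕ → ℂ) (B r : ℝ),
        (∀ n, IsPencilMember J (u n) (b n)) → (∀ n, ‖b n‖ ≤ B) →
        (∀ L : ℝ, ∃ n : ℕ, ∃ ξ : ℂ, ‖ξ‖ ≤ r ∧ L < ‖fderiv ℝ (fun w : ℂ => ι (u n w).1) ξ‖) →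
        CurveAway S p J := by
  intro S p J ε' hε' hball hJ2 hJs hJstd N ι hι hιinj hιd u b B r hu hB hblow
  -- (1) uniform confinement of members of bounded intercept on the disc `‖ξ‖ ≤ r + 2`
  obtain ⟨η, hη, -, hconf⟩ :=
    helper_memberUniform_of (helper_memberNearBound_of helper_memberFarCovers)
      S p J ε' hε' hball hJstd B (r + 2)
  have hK : IsCompact {x : punctured p | ¬ InPuncturedChartBall p η x} :=
    Summit.SmoothPoincare4.SmoothPoincare4.Cruxes.HyperbolicEnd.Sketch.isCompact_setOf_not_inPuncturedChartBall
      p hη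
  -- (2) a blow-up sequence: `‖ξ m‖ ≤ r`, `m < ‖d(ι ∘ u (n m))(ξ m)‖`
  choose n ξ hξ hgrad using fun m : ℕ => hblow (m : ℝ)
  -- (3)+(4) translate the blow-up points to the origin and rescale
  refine helper_rescaleAway jHolomorphicWeierstrassR4_holds S p J hJ2 hJs N ι hι hιinj hιd
    (fun m z => u (n m) (z + ξ m)) {x : punctured p | ¬ InPuncturedChartBall p η x} hK
    (fun m => isEntireJCurve_comp_add_right (hu (n m)).1 (ξ m)) ?_ ?_
  · -- the disc `‖z‖ ≤ 2` is mapped into the core `K`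
    intro m z hz
    refine hconf (u (n m)) (b (n m)) (hu (n m)) (hB (n m)) (z + ξ m) ?_
    calc ‖z + ξ m‖ ≤ ‖z‖ + ‖ξ m‖ := norm_add_le _ _
      _ ≤ 2 + r := add_le_add hz (hξ m)
      _ = r + 2 := add_comm _ _
  · -- the gradients at the origin are unbounded
    intro C
    obtain ⟨m, hm⟩ := exists_nat_gt C
    refine ⟨m, 0, by simp, ?_⟩
    rw [fderiv_translate_zero ι (u (n m)) (ξ m)]
    exact hm.trans (hgrad m)

end Summit.SmoothPoincare4.SmoothPoincare4.Theorems.WitnessCharge.PencilIncompleteness
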